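import Mathlib
import Literature.RepresentationTheory.FiniteGroups.IrreducibleCharacters
import Literature.RepresentationTheory.FiniteGroups.BrauerTheorem

/-!
# The CKSU axis family in `M × M × M` (`|M| = 17`): an explicit abelian graded simultaneous family
# at every exponent `2 + ε`, `ε ≥ 41/50`

Route `LevelGradedCohnUmans`, crux `GradedDesignFamily` (stmt-MatrixMultiplication-7610), registered stub
`abelianAxisFamily_of_le` (siege k2, explicit / elementary variation; an independent proof, kept in
its own namespace `…GradedDesignFamily.AxisProdK2`).

Everything is explicit.  Host: the abelian group `G = M × M × M` for a finite commutative group `M`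
(finally `M = Multiplicative (ZMod 17)`), test space `J = ⊤ = ℂ^G`, `t = 2` pieces
(Cohn–Kleinberg–Szegedy–Umans 2005, Prop. 5.2, the first simultaneous-triple-product family):

* piece `0`: `X₀ = {(u,1,1)}`, `Y₀ = {(1,v,1)}`, `Z₀ = {(1,1,w)}` (`u, v, w ≠ 1`),
* piece `1`: `X₁ = {(1,u,1)}`, `Y₁ = {(1,1,v)}`, `Z₁ = {(w,1,1)}`.

Separation (`axis_pattern`): a mixed quadruple product `x⁻¹ y y'⁻¹ z` (`x ∈ X_a, y ∈ Y_a, y' ∈ Y_b,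
z ∈ Z_b`) equals a target `x₀⁻¹ z₀` of piece `i` only on the diagonal `a = b = i, x = x₀, y = y',
z = z₀` — read off coordinatewise, the `8` cases `(a,b,i)` being closed by `simp`.  So the delta
function of `x₀⁻¹ z₀` (a member of `J = ⊤`) separates.  Budget (`budget_top_eq_card`): for an abelian
group every irreducible character has degree `1` (`IsIrrChar.map_one`) and `∑ χ(1)² = |G|`
(`sum_sq_charDegrees_holds`), so `∑_{χ ∈ Irr G ∩ J} χ(1)^{2+ε} = |G| = |M|³` at every exponent.
Volume: each piece has `(|M| - 1)³` triples, so the family inequality is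
`|M|³ < 2 · ((|M|-1)³)^{(2+ε)/3}` (`axisFamilyAt`); at `|M| = 17`, `ε ≥ 41/50` it reads
`4913 < 2 · 4096^{(2+ε)/3}`, which follows from `(4913/2)^50 < 4096^47` (`abelianAxisFamily_of_le`).
[cite: CohnKleinbergSzegedyUmans2005, Prop. 5.2]
-/

noncomputable section

set_option linter.dupNamespace false

open scoped BigOperators
open Literature.RepresentationTheory.FiniteGroups

namespace Summit.MatrixMultiplication.MatrixMultiplication.Theorems.GradedDesignFamily.AxisProdK2

/-- **The STPP pattern of the axis family, coordinatewise** (CKSU 2005, Prop. 5.2): in `M × M × M`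
(`M` a commutative group) with pieces `X = ((u,1,1) | (1,u,1))`, `Y = ((1,v,1) | (1,1,v))`,
`Z = ((1,1,w) | (w,1,1))` over non-identity parameters, the mixed quadruple product
`x⁻¹ y y'⁻¹ z` (`x ∈ X_a, y ∈ Y_a, y' ∈ Y_b, z ∈ Z_b`) hits the target `x₀⁻¹ z₀` of piece `i` only
on the diagonal.  Each of the `8` cases `(a, b, i)` is one coordinate equation.
[cite: CohnKleinbergSzegedyUmans2005, Prop. 5.2] -/
theorem axis_pattern {M : Type} [CommGroup M] (a b i : Fin 2) {u v v' w u₀ w₀ : M}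
    (hu : u ≠ 1) (hv : v ≠ 1) (hv' : v' ≠ 1) (hw : w ≠ 1) (hu₀ : u₀ ≠ 1) (hw₀ : w₀ ≠ 1)
    (hE : ((![(u, 1, 1), (1, u, 1)] : Fin 2 → M × M × M) a)⁻¹ *
          (![(1, v, 1), (1, 1, v)] : Fin 2 → M × M × M) a *
          ((![(1, v', 1), (1, 1, v')] : Fin 2 → M × M × M) b)⁻¹ *
          (![(1, 1, w), (w, 1, 1)] : Fin 2 → M × M × M) b =
        ((![(u₀, 1, 1), (1, u₀, 1)] : Fin 2 → M × M × M) i)⁻¹ *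
          (![(1, 1, w₀), (w₀, 1, 1)] : Fin 2 → M × M × M) i) :
    a = i ∧ b = i ∧ u = u₀ ∧ v = v' ∧ w = w₀ := by
  fin_cases a <;> fin_cases b <;> fin_cases i <;> simp_all [mul_inv_eq_one]

/-- **Graded budget of the full test space of a finite abelian group**: with `J = ⊤ = ℂ^G` the
graded budget `∑_{χ ∈ Irr G ∩ J} χ(1)^s` equals `|G|` at every exponent `s` — all irreducible
degrees are `1` (`IsIrrChar.map_one`) and `∑_χ χ(1)² = |G|` (`sum_sq_charDegrees_holds`) counts
the irreducible characters. [folklore] -/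
theorem budget_top_eq_card {G : Type} [Group G] [Fintype G] [IsMulCommutative G] (s : ℝ) :
    (∑ᶠ χ ∈ irrChars G ∩ ((⊤ : Submodule ℂ (G → ℂ)) : Set (G → ℂ)), (χ 1).re ^ s) =
      (Fintype.card G : ℝ) := by
  have hset : irrChars G ∩ ((⊤ : Submodule ℂ (G → ℂ)) : Set (G → ℂ)) = irrChars G := by
    rw [Submodule.top_coe, Set.inter_univ]
  have hfin : (irrChars G).Finite := irrChars_finite_holds G
  have hone : ∀ χ ∈ hfin.toFinset, χ 1 = 1 := fun χ hχ =>
    IsIrrChar.map_one (hfin.mem_toFinset.mp hχ)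
  have hre : ∑ χ ∈ hfin.toFinset, (χ 1).re ^ s = ∑ _χ ∈ hfin.toFinset, (1 : ℝ) :=
    Finset.sum_congr rfl fun χ hχ => by rw [hone χ hχ, Complex.one_re, Real.one_rpow]
  rw [hset, finsum_mem_eq_finite_toFinset_sum _ hfin, hre, Finset.sum_const, nsmul_eq_mul, mul_one]
  -- count the irreducible characters through `∑ χ(1)² = |G|`
  have hsq := sum_sq_charDegrees_holds G
  have hsq' : ∑ χ ∈ hfin.toFinset, χ 1 ^ 2 = ∑ _χ ∈ hfin.toFinset, (1 : ℂ) :=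
    Finset.sum_congr rfl fun χ hχ => by rw [hone χ hχ, one_pow]
  rw [finsum_mem_eq_finite_toFinset_sum _ hfin, hsq', Finset.sum_const, nsmul_eq_mul, mul_one,
    Nat.card_eq_fintype_card] at hsq
  have hcard : hfin.toFinset.card = Fintype.card G := by exact_mod_cast hsq
  rw [hcard]

/-- **The axis family of `M × M × M` as a graded simultaneous family** (CKSU 2005, Prop. 5.2, read
through the full test space): for a finite commutative group `M` and every real `ε` with
`|M|³ < 2 · ((|M| - 1)³)^{(2+ε)/3}`, the two pieces
`(X₀,Y₀,Z₀) = ({(u,1,1)}, {(1,v,1)}, {(1,1,w)})`, `(X₁,Y₁,Z₁) = ({(1,u,1)}, {(1,1,v)}, {(w,1,1)})`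
(parameters `≠ 1`) with `J = ⊤` form a bi-invariant, simultaneously `J`-separated family (separating
functions: the delta functions of the targets `x₀⁻¹ z₀`, by `axis_pattern`) whose graded budget
`|M|³` (`budget_top_eq_card`) is beaten by `∑_i (|X_i||Y_i||Z_i|)^{(2+ε)/3} = 2·((|M|-1)³)^{(2+ε)/3}`.
[cite: CohnKleinbergSzegedyUmans2005, Prop. 5.2] -/
theorem axisFamilyAt (M : Type) [CommGroup M] [Fintype M] (ε : ℝ)
    (hε : (Fintype.card M : ℝ) ^ 3 <
      2 * ((((Fintype.card M - 1) * (Fintype.card M - 1) * (Fintype.card M - 1) : ℕ)) : ℝ) ^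
        ((2 + ε) / 3)) :
    ∃ (G : Type) (_ : Group G) (_ : Fintype G) (J : Submodule ℂ (G → ℂ)) (t : ℕ)
      (X Y Z : Fin t → Finset G), (∀ f ∈ J, ∀ a b : G, (fun g : G => f (a * g * b)) ∈ J) ∧
      (∀ i : Fin t, ∀ x₀ ∈ X i, ∀ z₀ ∈ Z i, ∃ f ∈ J, ∀ a b : Fin t, ∀ x ∈ X a, ∀ y ∈ Y a,
        ∀ y' ∈ Y b, ∀ z ∈ Z b,
          ((a = i ∧ b = i ∧ x = x₀ ∧ y = y' ∧ z = z₀) → f (x⁻¹ * y * y'⁻¹ * z) = 1) ∧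
          (¬ (a = i ∧ b = i ∧ x = x₀ ∧ y = y' ∧ z = z₀) → f (x⁻¹ * y * y'⁻¹ * z) = 0)) ∧
      (∑ᶠ χ ∈ irrChars G ∩ (J : Set (G → ℂ)), (χ 1).re ^ (2 + ε)) <
        ∑ i, (((X i).card * (Y i).card * (Z i).card : ℕ) : ℝ) ^ ((2 + ε) / 3) := by
  classical
  refine ⟨M × M × M, inferInstance, inferInstance, ⊤, 2,
    fun a => (Finset.univ.erase (1 : M)).image fun u =>
      (![(u, 1, 1), (1, u, 1)] : Fin 2 → M × M × M) a,
    fun a => (Finset.univ.erase (1 : M)).image fun u =>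
      (![(1, u, 1), (1, 1, u)] : Fin 2 → M × M × M) a,
    fun a => (Finset.univ.erase (1 : M)).image fun u =>
      (![(1, 1, u), (u, 1, 1)] : Fin 2 → M × M × M) a,
    fun f _ a b => Submodule.mem_top, ?_, ?_⟩
  · -- simultaneous separation by the delta function of the target `x₀⁻¹ z₀`
    intro i x₀ hx₀ z₀ hz₀
    refine ⟨fun g => if g = x₀⁻¹ * z₀ then 1 else 0, Submodule.mem_top, ?_⟩
    intro a b x hx y hy y' hy' z hz
    simp only [Finset.mem_image, Finset.mem_erase, Finset.mem_univ, and_true] at hx hy hy' hz hx₀ hz₀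
    obtain ⟨u, hu, rfl⟩ := hx
    obtain ⟨v, hv, rfl⟩ := hy
    obtain ⟨v', hv', rfl⟩ := hy'
    obtain ⟨w, hw, rfl⟩ := hz
    obtain ⟨u₀, hu₀, rfl⟩ := hx₀
    obtain ⟨w₀, hw₀, rfl⟩ := hz₀
    refine ⟨?_, fun hnot => if_neg fun hE => hnot ?_⟩
    · rintro ⟨rfl, rfl, hxx, hyy, hzz⟩
      simp [hxx, hyy, hzz]
    · obtain ⟨rfl, rfl, rfl, rfl, rfl⟩ := axis_pattern a b i hu hv hv' hw hu₀ hw₀ hE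
      exact ⟨rfl, rfl, rfl, rfl, rfl⟩
  · -- budget `|M|³` against the total volume `2 · ((|M| - 1)³)^{(2+ε)/3}`
    haveI : IsMulCommutative (M × M × M) := ⟨⟨mul_comm⟩⟩
    rw [budget_top_eq_card (G := M × M × M) (2 + ε), Fin.sum_univ_two]
    simp only [Fin.isValue, Matrix.cons_val_zero, Matrix.cons_val_one]
    have h0 : Function.Injective fun u : M => ((u, 1, 1) : M × M × M) := fun u u' h => by
      simpa using h
    have h1 : Function.Injective fun u : M => ((1, u, 1) : M × M × M) := fun u u' h => by
      simpa using h
    have h2 : Function.Injective fun u : M => ((1, 1, u) : M × M × M) := fun u u' h => by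
      simpa using h
    rw [Finset.card_image_of_injective _ h0, Finset.card_image_of_injective _ h1,
      Finset.card_image_of_injective _ h2, Finset.card_erase_of_mem (Finset.mem_univ _),
      Finset.card_univ, Fintype.card_prod, Fintype.card_prod, ← two_mul]
    have hL : ((Fintype.card M * (Fintype.card M * Fintype.card M) : ℕ) : ℝ) =
        (Fintype.card M : ℝ) ^ 3 := by
      push_cast; ring
    rw [hL]
    exact hε

/-- **Numerical instance `|M| = 17` — the registered stub `abelianAxisFamily_of_le`.**  The axis
family of `C₁₇ × C₁₇ × C₁₇` is a graded simultaneous family at every exponent `2 + ε` with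
`ε ≥ 41/50`: the budget is `17³ = 4913`, the volume side is `2 · 4096^{(2+ε)/3} ≥ 2 · 4096^{47/50}`,
and `4913/2 < 4096^{47/50}` because `(4913/2)^50 < 4096^47`.  (The true threshold is
`ε > (3 log 17 - log 2)/log 16 - 2 = 0.8154…`; `|M| = 17` is the optimal order for this family.)
[cite: CohnKleinbergSzegedyUmans2005, Prop. 5.2] -/
theorem abelianAxisFamily_of_le (ε : ℝ) (hε : (41 : ℝ) / 50 ≤ ε) : ∃ (G : Type) (_ : Group G) (_ : Fintype G) (J : Submodule ℂ (G → ℂ)) (t : ℕ) (X Y Z : Fin t → Finset G), (∀ f ∈ J, ∀ a b : G, (fun g : G => f (a * g * b)) ∈ J) ∧ (∀ i : Fin t, ∀ x₀ ∈ X i, ∀ z₀ ∈ Z i, ∃ f ∈ J, ∀ a b : Fin t, ∀ x ∈ X a, ∀ y ∈ Y a, ∀ y' ∈ Y b, ∀ z ∈ Z b, ((a = i ∧ b = i ∧ x = x₀ ∧ y = y' ∧ z = z₀) → f (x⁻¹ * y * y'⁻¹ * z) = 1) ∧ (¬ (a = i ∧ b = i ∧ x = x₀ ∧ y = y' ∧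 z = z₀) → f (x⁻¹ * y * y'⁻¹ * z) = 0)) ∧ (∑ᶠ χ ∈ irrChars G ∩ (J : Set (G → ℂ)), (χ 1).re ^ (2 + ε)) < ∑ i, (((X i).card * (Y i).card * (Z i).card : ℕ) : ℝ) ^ ((2 + ε) / 3) := by
  refine axisFamilyAt (Multiplicative (ZMod 17)) ε ?_
  rw [Fintype.card_multiplicative, ZMod.card]
  have hvol : ((((17 - 1) * (17 - 1) * (17 - 1) : ℕ)) : ℝ) = 4096 := by norm_num
  have hbud : ((17 : ℕ) : ℝ) ^ 3 = 4913 := by norm_num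
  rw [hvol, hbud]
  -- `4096^{47/50} ≤ 4096^{(2+ε)/3}`
  have hmono : (4096 : ℝ) ^ ((47 : ℝ) / 50) ≤ (4096 : ℝ) ^ ((2 + ε) / 3) :=
    Real.rpow_le_rpow_of_exponent_le (by norm_num) (by linarith)
  -- `4913 / 2 < 4096^{47/50}` by comparing `50`-th powers
  have hpos : (0 : ℝ) ≤ (4096 : ℝ) ^ ((47 : ℝ) / 50) := Real.rpow_nonneg (by norm_num) _
  have h50 : ((4096 : ℝ) ^ ((47 : ℝ) / 50)) ^ (50 : ℕ) = (4096 : ℝ) ^ (47 : ℕ) := by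
    rw [← Real.rpow_natCast, ← Real.rpow_mul (by norm_num), ← Real.rpow_natCast]
    norm_num
  have hlt : ((4913 : ℝ) / 2) ^ (50 : ℕ) < ((4096 : ℝ) ^ ((47 : ℝ) / 50)) ^ (50 : ℕ) := by
    rw [h50]
    norm_num
  have hkey : (4913 : ℝ) / 2 < (4096 : ℝ) ^ ((47 : ℝ) / 50) := lt_of_pow_lt_pow_left₀ 50 hpos hlt
  linarith

end Summit.MatrixMultiplication.MatrixMultiplication.Theorems.GradedDesignFamily.AxisProdK2

end
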